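import Mathlib
import HarnessLib
import Summits.Schanuel.Schanuel.Theses.CyclotomicRigidity
import Literature.NumberTheory.Transcendental.KirbyWeakSchanuelAx
import Literature.Barriers.Schanuel.AxSchanuelFunctionalNotNumerical

/-!
# Birth skeleton (BC3) — crux `CyclotomicRigidity.TowerStrong` (stmt-Schanuel-5989)

Route `route-Schanuel-CyclotomicRigidity` (Schanuel = (free tower) + (strong tower)), crux #6 THE TOWER IS
STRONG IN `ℂ`: with `E ⊂ ℂ` the KERNEL-FREE TOWER — the smallest intermediate field of `ℂ/ℚ` containing
`ℚ̄ = algebraicClosure ℚ ℂ` and closed under `exp`, inlined everywhere as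
`sInf {K : IntermediateField ℚ ℂ | algebraicClosure ℚ ℂ ≤ K ∧ ∀ w ∈ K, cexp w ∈ K}` — for `z₁,…,zₙ ∈ ℂ`
`ℚ`-linearly independent MODULO `E` (no non-trivial rational combination lies in `E`),
`trdeg_E E(z₁,…,zₙ,e^{z₁},…,e^{zₙ}) ≥ n`. In Kirby's language (FPEF Def. 2.2) this is `E ◁ ℂ_exp`: the tower is
STRONGLY embedded in `ℂ_exp`.

This file is the route-level BIRTH CERTIFICATE skeleton of the crux (LENSES-v3 §2 BC3; registrar seat
`planner-skel-stmt-Schanuel-5989-0`, 2026-08-17, route re-audit bin REPAIRABLE): two NAMED stubs and a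
kernel-checked composition concluding the crux BY NAME.

## The seam: NUMERICAL CORE inside `ecl(∅)` × TRANSITIVITY OF STRONG EMBEDDINGS (+ Kirby's theorem, PROVED)

Two facts of the theory of exponential fields cut the crux:

1. (Kirby 2010 EAEF, Thm. 1.2 at `C = ecl ∅`; PROVED in the tree from Ax's theorem via Rosenlicht:
   `Literature.NumberTheory.Transcendental.kirby_relative_schanuel_complex_holds`) the exponential-algebraic
   closure `ecl(∅) ⊂ ℂ` — the countable E-subfield of coordinates of solutions of Khovanskii systems over `ℤ`,
   containing `ℚ̄`, `e`, `π`, `log α`, … — is STRONG in `ℂ_exp`: `ecl(∅) ◁ ℂ`.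
2. (Kirby 2013 FPEF, Lemma 2.3, 4th item: "if `F₁ ◁ F₂` and `F₂ ◁ F₃` then `F₁ ◁ F₃`") composites of strong
   extensions are strong.

Since `E ≤ ℚ(ecl ∅)` (`towerE_le_eclField`: `ℚ(ecl ∅)` is one of the `exp`-closed fields over `ℚ̄` of which `E`
is the infimum), `E ◁ ℂ` follows from `E ◁ ecl(∅)` alone: every exponentially TRANSCENDENTAL direction of a
tuple `z` is discharged by functional transcendence (Ax), and what is left is the tower-relative NUMERICAL CORE
over the countable field `ecl(∅)`. The skeleton is exactly this:

* `stub_strongInEcl` — THE NUMERICAL CORE `E ◁ ecl(∅)` (load-bearing, OPEN): for `z : Fin n → ℂ` with every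
  `zᵢ ∈ ecl ∅` and `z` `ℚ`-independent modulo `E`, `n ≤ trdeg_E E(z, e^z)` — the crux with its quantifier cut
  down to exponentially algebraic tuples. NOT the crux reworded: the crux gives it by restriction
  (`stub_strongInEcl_of_towerStrong`, one line), but it gives the crux back only THROUGH stub 2 and Kirby's
  theorem (BC3 probes below: no cheap implication). What the cut exposes: every instance is now a statement
  about a KHOVANSKII POINT — `z` extends to a solution `x ∈ (ecl ∅)^N` of an `N × N` exponential-polynomial
  system over `ℤ` with non-vanishing Jacobian, so the UPPER bound `trdeg_ℚ ℚ(x, eˣ) ≤ N` comes for free and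
  the lower bound asked for becomes GENERICITY OF KHOVANSKII POINTS OVER THE TOWER, the same currency as the
  sister crux `TowerSchanuel` (#5, "every step of the tower is generic"); `ecl ∅` is moreover the SMALLEST
  `ecl`-closed set, so this is the minimal residue the method leaves. It still contains the hard named
  instances (`πi, log 2, log 3 ∈ ecl ∅`): "`π` is transcendental over `E`" (⊇ `e ⊥ π`, as `e ∈ E`) and
  "`log 2, log 3` algebraically independent over `E`".
* `stub_strongTrans` — TRANSITIVITY OF `◁` THROUGH AN `exp`-CLOSED INTERMEDIATE FIELD (PROVABLE, M/L): for
  intermediate fields `F ≤ K` of `ℂ/ℚ` with `K` closed under `exp`, if `F` is strong in `K` (tuples FROM `K`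
  that are `ℚ`-independent modulo `F` have `trdeg_F F(z,e^z) ≥ n`) and `K` is strong in `ℂ` (tuples
  `ℚ`-independent modulo `K` have `trdeg_K K(x,eˣ) ≥ n`), then `F` is strong in `ℂ`. Proof plan (Kirby's
  "easy to verify", ≈ 200–400 lines of Lean): given `z` independent mod `F`, let `V = span_ℚ z`,
  `V_K = V ∩ K` (`dim k`), pick an integral basis `u ⊂ span_ℤ z` of `V_K` and indices `I`, `|I| = n − k`, with
  `z_I` independent modulo `V_K` (hence modulo `K`); then `M := F(u, e^u) ≤ K` (as `F ≤ K`, `u ⊂ K`, `K`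
  `exp`-closed) and `M ≤ L := F(z, e^z)` (integer combinations / integer powers), so
  `trdeg_F L ≥ trdeg_F M + trdeg_M L ≥ k + trdeg_K K(z_I, e^{z_I}) ≥ k + (n − k)` by the tower inequality
  (Mathlib `Algebra.trdeg_add_le`, tree `trdeg_add_le_of_le_subring`), strongness of `F` in `K` at `u`, base
  change `M ≤ K` (a transcendence basis of `K(S)/K` inside `S` stays independent over `M`), and strongness of
  `K` at `z_I`. A genuine lemma of the line (the composite-of-strong-extensions lemma for the triple
  `E ≤ ℚ(ecl ∅) ≤ ℂ`, stated for all `F ≤ K`), not bookkeeping: it is where the tower law and the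
  linear-algebra split live.
* `TowerStrong_of : Sig.stub_strongInEcl → Sig.stub_strongTrans → TowerStrong` — the SORRY-FREE composition
  (axioms `propext`, `Classical.choice`, `Quot.sound`): stub 2 at `F := E`, `K := ℚ(ecl ∅)`, fed with
  `towerE_le_eclField` (`ℚ̄ ≤ ecl ∅` by `Literature.Barriers.Schanuel.mem_ecl_of_isAlgebraic`, `exp`-closure by
  `Khovanskii.exp_mem_ecl`), stub 1 (through `mem_eclField_iff : a ∈ ℚ(ecl ∅) ↔ a ∈ ecl ∅`, from
  `adjoin_rat_le_of_isEclClosed` + `isEclClosed_ecl`), and `strong_eclField` = KIRBY'S THEOREM IN THE ROUTE'S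
  SPELLING (the route's "`∀ q, ∑ qᵢ xᵢ ∈ K → q = 0`" converted to `LinearIndependent ℚ (mkQ ∘ x)` modulo
  `span_ℚ (ecl ∅) ≤ ℚ(ecl ∅)`, then `kirby_relative_schanuel_complex_holds`).
* `TowerStrong_proof : TowerStrong` — the skeleton in its final shape (the crux BY NAME from the two registered
  stubs; depends on `sorryAx` through the stubs only).

Exactness: given the (provable) stub 2, `TowerStrong ↔ stub 1` (`→` restriction, `←` this file), so stub 1 is
not refutable short of `¬ TowerStrong`, itself refutable only together with Schanuel's conjecture (route
support `SchanuelImpliesLocalisation : Schanuel → TowerSchanuel ∧ TowerStrong`).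

## Disproof used / negatives / barriers

No `Cruxes/TowerStrong/Disproof.lean` exists (`ledger crux ls stmt-Schanuel-5989`: no workfiles, no crux
ideas, no cdisprove cycle; dead lines: none — 2026-08-17), so there is no `_false_without_` obstruction to
honour yet. `ledger negatives --problem Schanuel` (2026-08-17): 2 refuted statements (PolarPhantoms
stmt-Schanuel-6844/6846, "`trdeg ℚ(y, α) < n` for all `y, α`"-type), neither equal nor trivially equivalent to
either stub. Refuter evidence on the item (g41-0 `Structural.lean`, g41-5 `EBasics.lean`, 2026-08-15): `E` is
non-degenerate (`ℚ̄ ≤ E`, `exp`-closed, countable, `E ≠ ⊤`) and `E ≤ ecl ∅` — the inclusion this skeleton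
rides on, re-proved here as `towerE_le_eclField`.
Barrier `Literature.Barriers.Schanuel.AxSchanuelFunctionalNotNumerical` (Ax–Schanuel is functional, not
numerical; every E-derivation kills `ecl ∅`; the summit's residue is its restriction to `ecl ∅`): NOT evaded
but SPENT — stub 2 + Kirby cash in everything the functional method gives for the RELATIVE statement
`E ◁ ℂ`, and stub 1 is, by construction, inside the barrier's residue (tuples from `ecl ∅`), where no
derivation argument can help; it is the tower-relative analogue of Kirby's Prop. 7.2 / the tree's
`schanuelConjecture_iff_ecl_empty_holds` (used at SUMMIT level by route EclCore), here at crux level and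
strictly inside the summit's residue. Barrier `AlgebraicIndependenceOfLogarithms`: applies to stub 1
(`z = (log 2, log 3)`) exactly as to the crux — honest: it does; the route's bet for `TowerStrong` is
bookkeeping-for-honesty (rank 6, staffed last), and this skeleton only localises where the difficulty sits.

## Foreseen next split of stub 1 (NOT registered: no decomposition below a crux until something closes)

KERNEL FIRST: `stub_strongInEcl ⟸ (K) ∧ (S′)` with (K) "`π` is transcendental over `E`" (⊋ route support
`PiNotInTower`; contains `e ⊥ π`) and (S′) "`E(2πi)` is strong for exponentially algebraic tuples
`ℚ`-independent modulo `E ⊕ ℚ·2πi`" — because `span_ℚ(z) ∩ (E ⊕ ℚ 2πi)` has dimension `≤ 1` when `z` is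
independent mod `E`, and `e^{e₀ + r·2πi} ∈ ℚ̄·E = E`; it isolates the kernel of `exp` (the one place where
`ℂ_exp` differs from Kirby's kernel-free free constructions) as its own statement. Recorded for the lead
prover / tenure planner; the glue of that split is itself L-sized Lean (tower law + change of `ℚ`-basis).

## BC3 audit (this seat; raw outputs under `birth-certificate:` in the seat's NOTES.md)

`lean check --json` rc 0 with `sorry` exactly in `stub_strongInEcl`, `stub_strongTrans` (sorry count 2 =
stub count, zero elsewhere); `#print axioms TowerStrong_of` = [propext, Classical.choice, Quot.sound].
Probes, for `X ∈ {Sig.stub_strongInEcl, Sig.stub_strongTrans}` and target `T ∈ {TowerStrong, Schanuel}`: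
`example : X → T` by `first | exact? | simpa [X] | (unfold X; simpa) | aesop` (BC2 form), by the plain
`first | exact? | simpa | aesop` (payload form) and `(h : X)` by `first | exact? | simpa using h | aesop` —
ALL 12 FAIL (files `bc/probe_*.lean`); and, because a heartbeat timeout inside `exact?` aborts a `first`
block, every disjunct SEPARATELY (files `bc/probe2_*.lean`, 24 examples, all under `maxHeartbeats 400000`):
`exact?` → deterministic timeout at `whnf`, never closes (8/8); `simpa [X]`, `unfold X; simpa` →
"assumption failed", residual goal = the implication itself (8/8); `aesop` (also after unfolding `X` and
the target) → "failed to prove the goal after exhaustive search" resp. timeout (6/6; for stub 1 the stuck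
goal is the crux body for an ARBITRARY `z`, with no `z i ∈ ecl ∅` to feed the hypothesis); `simpa using h` →
type mismatch (4/4). 36 probes, 0 successes: no stub is cheaply the crux or the summit — stub 1 knows only
exponentially algebraic tuples, stub 2 knows no transcendence fact at all.

## References

* J. Kirby, *Exponential algebraicity in exponential fields*, Bull. LMS 42 (2010) 879–890, arXiv:0810.4285:
  Thm. 1.2, Lemma 3.3, §7, Prop. 7.2. [Kirby2010]
* J. Kirby, *Finitely presented exponential fields*, Algebra & Number Theory 7 (2013) 943–980,
  doi:10.2140/ant.2013.7.943, arXiv:0912.4019: Def. 2.2 (strong extensions `F ◁ F₁`), Lemma 2.3. [Kirby2013FPEF]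
* J. Ax, *On Schanuel's conjectures*, Ann. of Math. 93 (1971) 252–268, Thm. 3. [Ax1971]
* M. Waldschmidt, *Diophantine approximation on linear algebraic groups* (2000), Conj. 1.14. [Waldschmidt2000]
* Route file `Summits/Schanuel/Schanuel/Theses/CyclotomicRigidity.lean` (crux #6, supports
  `SchanuelImpliesLocalisation`, `Assembly`); barrier `Literature/Barriers/Schanuel/AxSchanuelFunctionalNotNumerical.lean`.
-/

set_option linter.dupNamespace false

noncomputable section

namespace Summit.Schanuel.Schanuel.Cruxes.TowerStrong.Birth

open Summit.Schanuel.Schanuel.Theses.CyclotomicRigidity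
open Literature.NumberTheory.Transcendental

/-! ### Vocabulary (proof-side abbreviations; the stub statements below are written out literally) -/

/-- The kernel-free tower `E` — verbatim the route's inlined expression: the smallest intermediate
field of `ℂ/ℚ` containing `ℚ̄ = algebraicClosure ℚ ℂ` and closed under `exp`. -/
abbrev towerE : IntermediateField ℚ ℂ :=
  sInf {K : IntermediateField ℚ ℂ | algebraicClosure ℚ ℂ ≤ K ∧ ∀ w ∈ K, Complex.exp w ∈ K}

/-- The field `ℚ(ecl ∅)` generated by Kirby's exponential-algebraic closure of `∅` in `ℂ_exp` (as a
set it IS `ecl ∅`, `mem_eclField_iff`); this is the base field of the tree's PROVED relative Schanuel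
theorem `kirby_relative_schanuel_complex_holds` (Kirby 2010, Thm. 1.2 at `C = ecl ∅`). -/
abbrev eclField : IntermediateField ℚ ℂ :=
  IntermediateField.adjoin ℚ (ecl (∅ : Set ℂ))

/-! ### Stub signatures (`Sig.stub_*`; the hypothesis heads of `TowerStrong_of` carry the registered
stub names) -/

/-- STUB 1 — THE NUMERICAL CORE: THE TOWER IS STRONG INSIDE THE EXPONENTIAL-ALGEBRAIC CLOSURE
(`E ◁ ecl(∅)`). For `z₁,…,zₙ` EXPONENTIALLY ALGEBRAIC (each `zᵢ ∈ ecl ∅`: a coordinate of a solution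
of a Khovanskii system over `ℤ`) and `ℚ`-linearly independent modulo `E`, `trdeg_E E(z, e^z) ≥ n`.
This is the crux `TowerStrong` with its quantifier `z : Fin n → ℂ` cut down to the COUNTABLE E-field
`ecl ∅ ⊇ E` (it contains `π`, `log α`, `e`, every classical constant); implied by the crux (restriction),
gives it back only through STUB 2 and Kirby's theorem. OPEN (contains `π` transcendental over `E` and
`log 2, log 3` algebraically independent over `E`). -/
def Sig.stub_strongInEcl : Prop :=
  ∀ (n : ℕ) (z : Fin n → ℂ), (∀ i, z i ∈ ecl (∅ : Set ℂ)) →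
    (∀ q : Fin n → ℚ, (∑ i, (q i : ℂ) * z i) ∈
        (sInf {K : IntermediateField ℚ ℂ | algebraicClosure ℚ ℂ ≤ K ∧ ∀ w ∈ K, Complex.exp w ∈ K} :
          IntermediateField ℚ ℂ) → q = 0) →
      (n : Cardinal) ≤ Algebra.trdeg
        ↥(sInf {K : IntermediateField ℚ ℂ | algebraicClosure ℚ ℂ ≤ K ∧ ∀ w ∈ K, Complex.exp w ∈ K} :
            IntermediateField ℚ ℂ)
        ↥(IntermediateField.adjoin
            ↥(sInf {K : IntermediateField ℚ ℂ | algebraicClosure ℚ ℂ ≤ K ∧ ∀ w ∈ K, Complex.exp w ∈ K} :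
                IntermediateField ℚ ℂ)
            (Set.range z ∪ Set.range (Complex.exp ∘ z)))

/-- STUB 2 — TRANSITIVITY OF STRONG EMBEDDINGS THROUGH AN `exp`-CLOSED INTERMEDIATE FIELD
(Kirby, *Finitely presented exponential fields*, Lemma 2.3: "if `F₁ ◁ F₂` and `F₂ ◁ F₃` then
`F₁ ◁ F₃`", here with `F₃ = ℂ_exp`). For intermediate fields `F ≤ K` of `ℂ/ℚ` with `K` closed under
`exp`: if `F` is strong in `K` (every tuple FROM `K` that is `ℚ`-independent modulo `F` has
`trdeg_F F(z, e^z) ≥ n`) and `K` is strong in `ℂ` (every tuple `ℚ`-independent modulo `K` has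
`trdeg_K K(x, eˣ) ≥ n`), then `F` is strong in `ℂ`. PROVABLE (pure transcendence-degree algebra,
M/L: split `span_ℚ(z) = (span ∩ K) ⊕ span(z_I)` with an integral basis `u` of `span ∩ K`, tower law
`trdeg_F F(z,e^z) ≥ trdeg_F F(u,e^u) + trdeg_{F(u,e^u)} F(z,e^z)`, base change `F(u,e^u) ≤ K`). -/
def Sig.stub_strongTrans : Prop :=
  ∀ (F K : IntermediateField ℚ ℂ), F ≤ K → (∀ w ∈ K, Complex.exp w ∈ K) →
    (∀ (n : ℕ) (z : Fin n → ℂ), (∀ i, z i ∈ K) →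
        (∀ q : Fin n → ℚ, (∑ i, (q i : ℂ) * z i) ∈ F → q = 0) →
          (n : Cardinal) ≤ Algebra.trdeg ↥F
            ↥(IntermediateField.adjoin ↥F (Set.range z ∪ Set.range (Complex.exp ∘ z)))) →
    (∀ (n : ℕ) (x : Fin n → ℂ),
        (∀ q : Fin n → ℚ, (∑ i, (q i : ℂ) * x i) ∈ K → q = 0) →
          (n : Cardinal) ≤ Algebra.trdeg ↥K
            ↥(IntermediateField.adjoin ↥K (Set.range x ∪ Set.range (Complex.exp ∘ x)))) →
    ∀ (n : ℕ) (z : Fin n → ℂ),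
      (∀ q : Fin n → ℚ, (∑ i, (q i : ℂ) * z i) ∈ F → q = 0) →
        (n : Cardinal) ≤ Algebra.trdeg ↥F
          ↥(IntermediateField.adjoin ↥F (Set.range z ∪ Set.range (Complex.exp ∘ z)))

/-! ### Registered stubs -/

/-- Registered stub 1 — the numerical core `E ◁ ecl(∅)` (load-bearing, OPEN). -/
theorem stub_strongInEcl : Sig.stub_strongInEcl := by
  sorry

/-- Registered stub 2 — transitivity of `◁` through an `exp`-closed intermediate field (PROVABLE, M/L;
Kirby FPEF Lemma 2.3). -/
theorem stub_strongTrans : Sig.stub_strongTrans := by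
  sorry

/-! ### Glue: the exponential-algebraic closure as an intermediate field, and Kirby's theorem in the
route's spelling (sorry-free) -/

/-- `ℚ(ecl ∅) = ecl ∅` as sets: `ecl ∅` is an `ecl`-closed subfield containing `ℚ`
(`adjoin_rat_le_of_isEclClosed`, `isEclClosed_ecl`). [cite: Kirby2010, Lemma 3.3] -/
theorem mem_eclField_iff {a : ℂ} : a ∈ eclField ↔ a ∈ ecl (∅ : Set ℂ) :=
  ⟨fun h => adjoin_rat_le_of_isEclClosed (isEclClosed_ecl (∅ : Set ℂ)) h,
   fun h => IntermediateField.subset_adjoin ℚ (ecl (∅ : Set ℂ)) h⟩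

/-- `ℚ(ecl ∅)` is closed under `exp` (Kirby Lemma 3.3, tree `Khovanskii.exp_mem_ecl`).
[cite: Kirby2010, Lemma 3.3] -/
theorem eclField_exp_mem : ∀ w ∈ eclField, Complex.exp w ∈ eclField := fun _ hw =>
  mem_eclField_iff.mpr (Khovanskii.exp_mem_ecl (mem_eclField_iff.mp hw))

/-- `ℚ̄ ≤ ℚ(ecl ∅)`: algebraic numbers are exponentially algebraic (Kirby §7; tree
`Literature.Barriers.Schanuel.mem_ecl_of_isAlgebraic`). [cite: Kirby2010, §7] -/
theorem algebraicClosure_le_eclField : algebraicClosure ℚ ℂ ≤ eclField := fun _ hx =>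
  mem_eclField_iff.mpr
    (Literature.Barriers.Schanuel.mem_ecl_of_isAlgebraic (∅ : Set ℂ) ((mem_algebraicClosure_iff).mp hx))

/-- The kernel-free tower lies inside the exponential-algebraic closure: `E ≤ ℚ(ecl ∅)` (the latter
is one of the `exp`-closed fields over `ℚ̄` whose infimum `E` is). [folklore] -/
theorem towerE_le_eclField : towerE ≤ eclField :=
  sInf_le ⟨algebraicClosure_le_eclField, eclField_exp_mem⟩

/-- **Kirby 2010 Thm. 1.2 in the route's spelling**: `ℚ(ecl ∅)` is STRONG in `ℂ_exp` — for
`x : Fin n → ℂ` with no non-trivial rational combination in `ℚ(ecl ∅)`,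
`n ≤ trdeg_{ℚ(ecl ∅)} ℚ(ecl ∅)(x, eˣ)`. From the tree's PROVED `kirby_relative_schanuel_complex_holds`
(Ax's theorem via Rosenlicht), converting the route's "`∀ q, ∑ qᵢ xᵢ ∈ K → q = 0`" into linear
independence of `x` modulo `span_ℚ (ecl ∅)`. [cite: Kirby2010, Thm. 1.2] -/
theorem strong_eclField (n : ℕ) (x : Fin n → ℂ)
    (hx : ∀ q : Fin n → ℚ, (∑ i, (q i : ℂ) * x i) ∈ eclField → q = 0) :
    (n : Cardinal) ≤ Algebra.trdeg ↥eclField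
      ↥(IntermediateField.adjoin ↥eclField (Set.range x ∪ Set.range (Complex.exp ∘ x))) := by
  refine kirby_relative_schanuel_complex_holds n x ?_
  rw [Fintype.linearIndependent_iff]
  intro g hg
  have h1 : (Submodule.span ℚ (ecl (∅ : Set ℂ))).mkQ (∑ i, (g i : ℂ) * x i) = 0 := by
    rw [map_sum]
    refine Eq.trans (Finset.sum_congr rfl fun i _ => ?_) hg
    rw [Function.comp_apply, ← map_smul]
    exact congrArg _ (Rat.smul_def (g i) (x i)).symm
  rw [Submodule.mkQ_apply, Submodule.Quotient.mk_eq_zero] at h1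
  have hle : Submodule.span ℚ (ecl (∅ : Set ℂ)) ≤ Subalgebra.toSubmodule eclField.toSubalgebra :=
    Submodule.span_le.mpr fun a ha => IntermediateField.subset_adjoin ℚ (ecl (∅ : Set ℂ)) ha
  have h2 : (∑ i, (g i : ℂ) * x i) ∈ eclField := hle h1
  exact fun i => congrFun (hx g h2) i

/-! ### Composition -/

/-- **THE SKELETON THEOREM.** The crux `Summit.Schanuel.Schanuel.Theses.CyclotomicRigidity.TowerStrong`
(`E ◁ ℂ_exp`), concluded BY NAME from the two declared stubs: transitivity (stub 2) applied to
`E ≤ ℚ(ecl ∅) ≤ ℂ`, with `E ◁ ℚ(ecl ∅)` = stub 1 and `ℚ(ecl ∅) ◁ ℂ` = Kirby's theorem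
(`strong_eclField`, PROVED in the tree). Sorry-free. [cite: Kirby2010, Thm. 1.2] -/
theorem TowerStrong_of (hcore : Sig.stub_strongInEcl) (htrans : Sig.stub_strongTrans) :
    TowerStrong := by
  intro n z hz
  exact htrans towerE eclField towerE_le_eclField eclField_exp_mem
    (fun m w hwK hwE => hcore m w (fun i => mem_eclField_iff.mp (hwK i)) hwE)
    strong_eclField n z hz

/-- The skeleton in its final shape: the crux BY NAME from the two registered stubs (depends on
`sorryAx` through the stubs only). -/
theorem TowerStrong_proof : TowerStrong :=
  TowerStrong_of stub_strongInEcl stub_strongTrans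

/-! ### Sanity: the crux gives stub 1 back (restriction), so stub 1 is not refutable short of
`¬ TowerStrong` (itself a consequence of Schanuel's conjecture, route support
`SchanuelImpliesLocalisation`). -/

/-- `TowerStrong → stub 1` (restriction of the quantifier). [folklore] -/
theorem stub_strongInEcl_of_towerStrong (h : TowerStrong) : Sig.stub_strongInEcl :=
  fun n z _ hz => h n z hz

end Summit.Schanuel.Schanuel.Cruxes.TowerStrong.Birth

end
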